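import Mathlib
import HarnessLib
import Summits.RiemannHypothesis.RiemannHypothesis.Theses.RuelleBand
import Literature.Analysis.OperatorTheory.CompactPerturbationSpectrum
import Literature.Analysis.OperatorTheory.CompactNearIdentityFiniteDim
import Summits.RiemannHypothesis.RiemannHypothesis.Theorems.AsymptoticCriticalLine.Negative.Lindelof
import Literature.Barriers.RiemannHypothesis.LindelofBacklundProofs

/-!
# RuelleBand / `BandRealisation → AsymptoticCriticalLine`: the Faure–Tsujii engine

Route `RiemannHypothesis/RuelleBand`, item stmt-RiemannHypothesis-2062 (`BandRealisation`,
support rank 3), helper file (`--supports`). Companion of `RuelleBandBandRealisation.lean`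
(`AsymptoticCriticalLine → BandRealisation`); together the two files make the route's HONESTY
clause `BandRealisation ⟺ AsymptoticCriticalLine` a theorem of the tree, so that the item
`BandRealisation` is exactly as open as the crux `AsymptoticCriticalLine` (stmt-RiemannHypothesis-2063).

The engine (the route's support `BandEngine`, here in unfolded form `finite_jointEigenvalues`):
let `t ↦ T t` be a one-parameter GROUP of bounded operators on a complex Hilbert space with
`T t₀ - U` compact for some `t₀ > 0` and `U` unitary. Then for every `ε > 0` the joint
eigenvalues `z` (`T t v = e^{tz} v`, `v ≠ 0`) with `|Re z| ≥ ε` form a finite set. Proof: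

* `T (-t₀) - U⋆ = T(-t₀) (U - T t₀) U⋆` is compact too, so BOTH `B = T (±t₀)` are invertible,
  unitary-plus-compact operators, and a joint eigenvalue with `Re z ≥ ε` (resp. `≤ -ε`) gives an
  eigenvalue `e^{∓t₀ z}` of `T(∓t₀)` in the closed disc of radius `e^{-t₀ ε} < 1`;
* `finite_eigenvalues_norm_le`: such a `B` has only finitely many eigenvalues in a closed disc of
  radius `< 1` — the open unit disc lies in `ρ(V)` (`σ(V) ⊆` unit circle), `0 ∈ ρ(B)`, so by the
  analytic Fredholm theorem in the tree's form
  `Literature.Analysis.OperatorTheory.spectrum_add_compact_isolated_eigenvalues` the spectrum of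
  `B` in the disc is discrete, and an infinite set of eigenvalues in the compact smaller disc would
  accumulate (Reed–Simon I, Thm. VI.14; Gohberg–Krein);
* `finiteDimensional_eigenspace`: each such eigenspace is the fixed space of the compact operator
  `R_V(μ)(B - V)`, finite-dimensional by Riesz
  (`Literature.Analysis.OperatorTheory.finiteDimensional_of_isCompactOperator_of_norm_sub_le`);
* `finite_jointEigenvalues_fibre`: inside a finite-dimensional subspace, joint eigenvalues `z`
  with prescribed `e^{τ z}` are finitely many: `z ↦ e^{√2 τ z}` is injective on them
  (`√2 ∉ ℚ`) and eigenvectors of `T (√2 τ)` for distinct eigenvalues are linearly independent.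

Finally `asymptoticCriticalLine_of_bandRealisation : BandRealisation → AsymptoticCriticalLine`
(the route's support `RealisationToAsymptotic`): a zero `ρ` with `|Re ρ - 1/2| ≥ ε` is a joint
eigenvalue `ρ - 1/2`; and the COST FLOOR of the item
(`lindelof_and_density_of_bandRealisation`): through the crux disprover's
`Negative.Lindelof.lindelof_of_acl` / `densityHypothesis_of_acl` and the tree's proof of
Titchmarsh's Theorem 13.5, any witness of `BandRealisation` proves the Lindelöf and the Density
hypotheses. Mathlib + the tree's operator-theory files; no new definitions.
-/

noncomputable section

-- D-0017: `Summit.<S>.<S>.…` is the designed namespace of a single-problem summit.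
set_option linter.dupNamespace false

namespace Summit.RiemannHypothesis.RiemannHypothesis.Theorems

open Filter Topology Metric Set
open Summit.RiemannHypothesis.RiemannHypothesis.Theses.RuelleBand
open Literature.Analysis.OperatorTheory

variable {H : Type} [NormedAddCommGroup H] [InnerProductSpace ℂ H] [CompleteSpace H]

omit [CompleteSpace H] in
/-- An eigenvalue of a bounded operator lies in its spectrum (`μ - A` is not injective).
[folklore] -/
theorem mem_spectrum_of_apply_eq_smul {A : H →L[ℂ] H} {μ : ℂ} {v : H} (hv : v ≠ 0)
    (h : A v = μ • v) : μ ∈ spectrum ℂ A := by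
  rw [spectrum.mem_iff]
  rintro ⟨u, hu⟩
  apply hv
  have h1 : (algebraMap ℂ (H →L[ℂ] H) μ - A) v = 0 := by
    simp [Algebra.algebraMap_eq_smul_one, h]
  have h2 : ((↑u⁻¹ : H →L[ℂ] H) * ↑u) v = v := by simp
  rw [mul_apply_eq_comp, hu, h1, map_zero] at h2
  exact h2.symm

/-- The open unit disc lies in the resolvent set of a unitary (`σ(V) ⊆` unit circle). [folklore] -/
theorem ball_subset_resolventSet_of_unitary {V : H →L[ℂ] H} (hV : V ∈ unitary (H →L[ℂ] H)) :
    ball (0 : ℂ) 1 ⊆ resolventSet ℂ V := by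
  intro z hz
  rw [spectrum.mem_resolventSet_iff, ← spectrum.notMem_iff]
  intro hzσ
  have h1 := spectrum.norm_eq_one_of_unitary hV hzσ
  rw [mem_ball, dist_zero_right] at hz
  linarith

/-- **Finitely many eigenvalues in a small disc.** If `B` is invertible and `B - V` is compact
for a unitary `V`, then `B` has only finitely many eigenvalues of modulus `≤ ρ < 1`: by the
analytic Fredholm theorem (tree: `spectrum_add_compact_isolated_eigenvalues`, applied on the open
unit disc `⊆ ρ(V)` with the resolvent point `0`) the spectrum of `B` in the open unit disc is
discrete, and an infinite set of eigenvalues in the compact disc `‖μ‖ ≤ ρ` would have an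
accumulation point there (Reed–Simon I, Thm. VI.14 and its Corollary). [folklore] -/
theorem finite_eigenvalues_norm_le {B V : H →L[ℂ] H} (hV : V ∈ unitary (H →L[ℂ] H))
    (hK : IsCompactOperator (B - V)) (hB : IsUnit B) {ρ : ℝ} (hρ : ρ < 1) :
    {μ : ℂ | ‖μ‖ ≤ ρ ∧ ∃ v : H, v ≠ 0 ∧ B v = μ • v}.Finite := by
  have hD : IsOpen (ball (0 : ℂ) 1) := isOpen_ball
  have hDc : IsConnected (ball (0 : ℂ) 1) :=
    (convex_ball (0 : ℂ) 1).isConnected ⟨0, mem_ball_self one_pos⟩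
  have hDS := ball_subset_resolventSet_of_unitary hV
  have h0ρ : (0 : ℂ) ∈ resolventSet ℂ (V + (B - V)) := by
    rw [add_sub_cancel, spectrum.mem_resolventSet_iff, map_zero, zero_sub, IsUnit.neg_iff]
    exact hB
  obtain ⟨h1, -⟩ := spectrum_add_compact_isolated_eigenvalues V (B - V) hK hD hDc hDS
    (mem_ball_self one_pos) h0ρ
  rw [add_sub_cancel] at h1
  by_contra hinf
  obtain ⟨x, hx, hacc⟩ := Set.Infinite.exists_accPt_of_subset_isCompact hinf
    (isCompact_closedBall (0 : ℂ) ρ) fun μ hμ => mem_closedBall_zero_iff.2 hμ.1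
  have hxD : x ∈ ball (0 : ℂ) 1 := by
    rw [mem_closedBall_zero_iff] at hx
    exact mem_ball_zero_iff.2 (hx.trans_lt hρ)
  obtain ⟨y, ⟨-, v, hv0, hv⟩, hyρ⟩ :=
    ((accPt_iff_frequently_nhdsNE.1 hacc).and_eventually (h1 x hxD)).exists
  exact spectrum.mem_iff.1 (mem_spectrum_of_apply_eq_smul hv0 hv)
    (spectrum.mem_resolventSet_iff.1 hyρ)

/-- **Eigenspaces off the unit circle are finite-dimensional.** If `B - V` is compact with `V`
unitary and `‖μ‖ < 1`, the `μ`-eigenspace of `B` is finite-dimensional: it is fixed by the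
compact operator `R_V(μ) (B - V)`, and Riesz's lemma applies
(tree: `finiteDimensional_of_isCompactOperator_of_norm_sub_le` with `c = 0`). [folklore] -/
theorem finiteDimensional_eigenspace {B V : H →L[ℂ] H} (hV : V ∈ unitary (H →L[ℂ] H))
    (hK : IsCompactOperator (B - V)) {μ : ℂ} (hμ : ‖μ‖ < 1) :
    FiniteDimensional ℂ (algebraMap ℂ (H →L[ℂ] H) μ - B).ker := by
  have hμρ : μ ∈ resolventSet ℂ V :=
    ball_subset_resolventSet_of_unitary hV (mem_ball_zero_iff.2 hμ)
  have hR : resolvent V μ * (algebraMap ℂ (H →L[ℂ] H) μ - V) = 1 := by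
    rw [spectrum.resolvent_eq hμρ]
    exact hμρ.val_inv_mul
  have hC : IsCompactOperator (resolvent V μ * (B - V)) := hK.clm_comp (resolvent V μ)
  refine finiteDimensional_of_isCompactOperator_of_norm_sub_le hC _
    (ContinuousLinearMap.isClosed_ker _) zero_lt_one fun v hv => ?_
  rw [LinearMap.mem_ker] at hv
  have hBv : (B - V) v = (algebraMap ℂ (H →L[ℂ] H) μ - V) v := by
    have : (algebraMap ℂ (H →L[ℂ] H) μ - B) v = 0 := hv
    rw [sub_apply, sub_eq_zero] at this
    rw [sub_apply, sub_apply, this]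
  have hCv : (resolvent V μ * (B - V)) v = v := by
    rw [mul_apply_eq_comp, hBv, ← mul_apply_eq_comp, hR, one_apply_eq_self]
  rw [hCv, sub_self, norm_zero, zero_mul]

/-- Two joint characters `t ↦ e^{tz}`, `t ↦ e^{tz'}` of `ℝ` that agree at the times `τ ≠ 0` and
`√2 τ` are equal: `τ(z - z') ∈ 2πiℤ` and `√2 τ (z - z') ∈ 2πiℤ` force `z = z'` because `√2` is
irrational. [folklore] -/
theorem eq_of_cexp_eq_of_cexp_sqrt_two_eq {τ : ℝ} (hτ : τ ≠ 0) {z z' : ℂ}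
    (h1 : Complex.exp (τ * z) = Complex.exp (τ * z'))
    (h2 : Complex.exp (↑(Real.sqrt 2 * τ) * z) = Complex.exp (↑(Real.sqrt 2 * τ) * z')) :
    z = z' := by
  obtain ⟨k, hk⟩ := Complex.exp_eq_exp_iff_exists_int.1 h1
  obtain ⟨m, hm⟩ := Complex.exp_eq_exp_iff_exists_int.1 h2
  have h2πI : (2 * Real.pi * Complex.I : ℂ) ≠ 0 := by
    simp [Real.pi_ne_zero, Complex.I_ne_zero]
  -- `√2 k = m`
  have hkm : (Real.sqrt 2 : ℂ) * k = m := by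
    have e1 : (τ : ℂ) * (z - z') = k * (2 * Real.pi * Complex.I) := by linear_combination hk
    have e2 : (↑(Real.sqrt 2 * τ) : ℂ) * (z - z') = m * (2 * Real.pi * Complex.I) := by
      linear_combination hm
    have e3 : (m : ℂ) * (2 * Real.pi * Complex.I) =
        (Real.sqrt 2 : ℂ) * k * (2 * Real.pi * Complex.I) := by
      rw [← e2, Complex.ofReal_mul, mul_assoc, e1]
      ring
    exact (mul_right_cancel₀ h2πI e3).symm
  by_cases hk0 : k = 0
  · subst hk0
    have : (τ : ℂ) * (z - z') = 0 := by linear_combination hk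
    rcases mul_eq_zero.1 this with h | h
    · exact absurd (Complex.ofReal_eq_zero.1 h) hτ
    · exact sub_eq_zero.1 h
  · exfalso
    have hreal : Real.sqrt 2 * k = m := by exact_mod_cast hkm
    have hk0' : (k : ℝ) ≠ 0 := by exact_mod_cast hk0
    exact (irrational_iff_ne_rational _).1 irrational_sqrt_two m k hk0
      (by rw [← hreal]; field_simp)

omit [CompleteSpace H] in
/-- **The fibre over one eigenvalue is finite.** Let `W` be a finite-dimensional subspace and
`τ ≠ 0`. The joint eigenvalues `z` of the family `T` with `e^{τ z} = μ` whose eigenvector lies in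
`W` form a finite set: `z ↦ e^{√2 τ z}` is injective on them (`eq_of_cexp_eq_of_cexp_sqrt_two_eq`)
and the eigenvectors of the single operator `T (√2 τ)` for distinct eigenvalues are linearly
independent (`Module.End.eigenvectors_linearIndependent'`), inside `W`. [folklore] -/
theorem finite_jointEigenvalues_fibre (T : ℝ → H →L[ℂ] H) (W : Submodule ℂ H)
    [FiniteDimensional ℂ W] {τ : ℝ} (hτ : τ ≠ 0) (μ : ℂ) :
    {z : ℂ | Complex.exp (τ * z) = μ ∧
      ∃ v ∈ W, v ≠ 0 ∧ ∀ t : ℝ, T t v = Complex.exp (t * z) • v}.Finite := by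
  set F := {z : ℂ | Complex.exp (τ * z) = μ ∧
      ∃ v ∈ W, v ≠ 0 ∧ ∀ t : ℝ, T t v = Complex.exp (t * z) • v} with hF
  have hch : ∀ z : F, ∃ v ∈ W, v ≠ 0 ∧ ∀ t : ℝ, T t v = Complex.exp (t * (z : ℂ)) • v :=
    fun z => z.2.2
  choose v hvW hv0 hv using hch
  set t₁ : ℝ := Real.sqrt 2 * τ with ht₁
  -- the characters at time `t₁` are injective on the fibre
  have hinj : Function.Injective fun z : F => Complex.exp (↑t₁ * (z : ℂ)) := by
    intro z z' h
    apply Subtype.ext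
    refine eq_of_cexp_eq_of_cexp_sqrt_two_eq hτ ?_ h
    rw [z.2.1, z'.2.1]
  -- hence the eigenvectors are linearly independent, inside the finite-dimensional `W`
  have hli : LinearIndependent ℂ v := by
    refine Module.End.eigenvectors_linearIndependent' (T t₁ : H →ₗ[ℂ] H)
      (fun z : F => Complex.exp (↑t₁ * (z : ℂ))) hinj v fun z => ⟨?_, hv0 z⟩
    rw [Module.End.mem_eigenspace_iff]
    exact hv z t₁
  have hli' : LinearIndependent ℂ fun z : F => (⟨v z, hvW z⟩ : W) :=
    LinearIndependent.of_comp W.subtype (by simpa [Function.comp_def] using hli)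
  haveI : Finite F := hli'.finite
  exact Set.toFinite F

/-- **One side of the engine.** If `B = T τ` (`τ ≠ 0`) is invertible and unitary-plus-compact,
then for `ρ < 1` the joint eigenvalues `z` of `T` with `‖e^{τ z}‖ ≤ ρ` form a finite set: they
lie over the finitely many eigenvalues of `T τ` in the disc `‖μ‖ ≤ ρ`
(`finite_eigenvalues_norm_le`), with finite fibres (`finite_jointEigenvalues_fibre` in the
finite-dimensional eigenspaces `finiteDimensional_eigenspace`). [folklore] -/
theorem finite_jointEigenvalues_side (T : ℝ → H →L[ℂ] H) {τ : ℝ} (hτ : τ ≠ 0) {V : H →L[ℂ] H}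
    (hV : V ∈ unitary (H →L[ℂ] H)) (hK : IsCompactOperator (T τ - V)) (hB : IsUnit (T τ))
    {ρ : ℝ} (hρ : ρ < 1) :
    {z : ℂ | ‖Complex.exp (τ * z)‖ ≤ ρ ∧
      ∃ v : H, v ≠ 0 ∧ ∀ t : ℝ, T t v = Complex.exp (t * z) • v}.Finite := by
  have hE := finite_eigenvalues_norm_le hV hK hB hρ
  refine (hE.biUnion (t := fun μ => {z : ℂ | Complex.exp (τ * z) = μ ∧
      ∃ v ∈ (algebraMap ℂ (H →L[ℂ] H) μ - T τ).ker, v ≠ 0 ∧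
        ∀ t : ℝ, T t v = Complex.exp (t * z) • v}) fun μ hμ => ?_).subset ?_
  · haveI := finiteDimensional_eigenspace hV hK (hμ.1.trans_lt hρ)
    exact finite_jointEigenvalues_fibre T _ hτ μ
  · rintro z ⟨hz, v, hv0, hv⟩
    simp only [mem_iUnion, mem_setOf_eq, exists_prop]
    refine ⟨Complex.exp (τ * z), ⟨hz, v, hv0, hv τ⟩, rfl, v, ?_, hv0, hv⟩
    rw [LinearMap.mem_ker]
    show (algebraMap ℂ (H →L[ℂ] H) (Complex.exp (τ * z)) - T τ) v = 0
    rw [sub_apply, hv τ, ContinuousLinearMap.algebraMap_apply, sub_self]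

/-- **The Faure–Tsujii / Weyl engine** (the route's support `BandEngine`, unfolded): for a
one-parameter group `T` of bounded operators on a complex Hilbert space (`T 0 = 1`,
`T (s + t) = T s ∘ T t`; no continuity) with `T t₀ - U` compact for some `t₀ > 0` and `U`
unitary, the joint eigenvalues `z` with `|Re z| ≥ ε` form a finite set, for every `ε > 0`.
Both `T t₀` and `T (-t₀) = (T t₀)⁻¹` are invertible and unitary-plus-compact
(`T(-t₀) - U⋆ = T(-t₀)(U - T t₀)U⋆`), and a joint eigenvalue with `Re z ≥ ε` (resp. `≤ -ε`) has
`‖e^{∓t₀ z}‖ ≤ e^{-t₀ ε} < 1`, so `finite_jointEigenvalues_side` applies to `τ = ∓t₀`.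
(Faure–Tsujii 2013 §3; Reed–Simon I Thm. VI.14.) [folklore] -/
theorem finite_jointEigenvalues (T : ℝ → H →L[ℂ] H) (h0 : T 0 = ContinuousLinearMap.id ℂ H)
    (hadd : ∀ s t : ℝ, T (s + t) = (T s).comp (T t)) {t₀ : ℝ} (ht₀ : 0 < t₀) {U : H →L[ℂ] H}
    (hU : U ∈ unitary (H →L[ℂ] H)) (hK : IsCompactOperator (T t₀ - U)) {ε : ℝ} (hε : 0 < ε) :
    {z : ℂ | ε ≤ |z.re| ∧ ∃ v : H, v ≠ 0 ∧ ∀ t : ℝ, T t v = Complex.exp (t * z) • v}.Finite := by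
  -- `T t₀` and `T (-t₀)` are mutually inverse
  have hmul : ∀ s t : ℝ, T s * T t = T (s + t) := fun s t => by
    rw [ContinuousLinearMap.mul_def, hadd]
  have hone : T 0 = 1 := h0
  have hinv1 : T t₀ * T (-t₀) = 1 := by rw [hmul, add_neg_cancel, hone]
  have hinv2 : T (-t₀) * T t₀ = 1 := by rw [hmul, neg_add_cancel, hone]
  have hB : IsUnit (T t₀) := ⟨⟨T t₀, T (-t₀), hinv1, hinv2⟩, rfl⟩
  have hB' : IsUnit (T (-t₀)) := ⟨⟨T (-t₀), T t₀, hinv2, hinv1⟩, rfl⟩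
  -- `T (-t₀) - U⋆` is compact
  have hU' : star U ∈ unitary (H →L[ℂ] H) := Unitary.star_mem hU
  have hK' : IsCompactOperator (T (-t₀) - star U) := by
    have halg : T (-t₀) - star U = T (-t₀) * (U - T t₀) * star U := by
      rw [mul_sub, sub_mul, mul_assoc (T (-t₀)) U, Unitary.mul_star_self_of_mem hU, mul_one,
        hinv2, one_mul]
    have hneg : IsCompactOperator (U - T t₀) := by
      rw [← neg_sub]
      exact hK.neg
    rw [halg]
    exact (hneg.clm_comp (T (-t₀))).comp_clm (star U)
  -- the radius
  set ρ : ℝ := Real.exp (-(t₀ * ε)) with hρ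
  have hρ1 : ρ < 1 := Real.exp_lt_one_iff.2 (by nlinarith)
  have hfinP := finite_jointEigenvalues_side T (neg_ne_zero.2 ht₀.ne') hU' hK' hB' hρ1
  have hfinM := finite_jointEigenvalues_side T ht₀.ne' hU hK hB hρ1
  refine (hfinP.union hfinM).subset ?_
  rintro z ⟨hz, v, hv0, hv⟩
  rcases le_abs'.1 hz with h | h
  · -- `Re z ≤ -ε`: use `T t₀`
    right
    refine ⟨?_, v, hv0, hv⟩
    rw [Complex.norm_exp, Complex.re_ofReal_mul, hρ]
    exact Real.exp_le_exp.2 (by nlinarith)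
  · -- `Re z ≥ ε`: use `T (-t₀)`
    left
    refine ⟨?_, v, hv0, hv⟩
    rw [Complex.norm_exp, Complex.re_ofReal_mul, hρ]
    exact Real.exp_le_exp.2 (by nlinarith)

/-- **`BandRealisation → AsymptoticCriticalLine`** (the route's support `RealisationToAsymptotic`,
proved; Faure–Tsujii: "unitary modulo compact on the first band ⇒ all but finitely many
resonances in every strip around the line"): a zero `ρ` of `ζ` in the open strip with
`|Re ρ - 1/2| ≥ ε` is, by clause (ii) of `BandRealisation`, a joint eigenvalue `z = ρ - 1/2` with
`|Re z| ≥ ε` of the realising group, and those are finitely many by the engine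
`finite_jointEigenvalues`. Hence the item `BandRealisation` (stmt-RiemannHypothesis-2062)
implies the open crux `AsymptoticCriticalLine` (stmt-RiemannHypothesis-2063): it cannot be
settled short of that crux. [folklore] -/
theorem asymptoticCriticalLine_of_bandRealisation (h : BandRealisation) :
    AsymptoticCriticalLine := by
  obtain ⟨H, _, _, _, T, h0, hadd, ⟨t₀, ht₀, U, hU, hK⟩, heig⟩ := h
  intro ε hε
  have hfin := finite_jointEigenvalues T h0 hadd ht₀ hU hK hε
  refine (hfin.preimage (f := fun s : ℂ => s - 1 / 2) sub_left_injective.injOn).subset ?_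
  rintro s ⟨hs, h0', h1, hε'⟩
  obtain ⟨v, hv0, hv⟩ := heig s hs h0' h1
  refine ⟨?_, v, hv0, hv⟩
  have : (s - 1 / 2).re = s.re - 1 / 2 := by simp [Complex.sub_re]
  rw [this]
  exact hε'

/-- **COST FLOOR of the item.** Any witness of `BandRealisation` (stmt-RiemannHypothesis-2062)
proves the Lindelöf hypothesis and the Density hypothesis: `BandRealisation → AsymptoticCriticalLine`
(this file) and the crux disprover's `AsymptoticCriticalLine → LH` / `→ DH`
(`Negative.Lindelof.lindelof_of_acl`, `densityHypothesis_of_acl`: Backlund's condition +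
Titchmarsh's Theorem 13.5, proved in tree as `Titchmarsh1986_thm13_5_holds`; Ingham at `σ = 1/2`). So the item is open on the positive side at least as hard as
Lindelöf. [folklore] -/
theorem lindelof_and_density_of_bandRealisation (h : BandRealisation) :
    Literature.NumberTheory.LFunctions.LindelofHypothesis ∧
      Literature.NumberTheory.LFunctions.DensityHypothesis :=
  ⟨AsymptoticCriticalLine.Negative.lindelof_of_acl
      Literature.Barriers.RiemannHypothesis.Titchmarsh1986_thm13_5_holds
      (asymptoticCriticalLine_of_bandRealisation h),
    AsymptoticCriticalLine.Negative.densityHypothesis_of_acl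
      (asymptoticCriticalLine_of_bandRealisation h)⟩

end Summit.RiemannHypothesis.RiemannHypothesis.Theorems

end
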